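import Literature.MathematicalPhysics.QuantumFieldTheory.Balaban1983to89.B9Thm34TowerVacuumLadder
import Literature.MathematicalPhysics.QuantumFieldTheory.Balaban1983to89.B9Eq342MajorantReadingSeam
import Literature.MathematicalPhysics.QuantumFieldTheory.Balaban1983to89.B6Ineq249Proof

/-!
# `Balaban1983to89.B9Thm34TowerVacuumLadderRows` — T. Bałaban, *Propagators for lattice gauge theories in a background field*, Commun. Math. Phys. **99** (1985) 389–434
# [Balaban1985BackgroundPropagators] Thm 3.4 p. 400, Thm 3.1 (3.42) p. 397 («for x ∈ Δ(y), y ∈ Λ_j, supp λ ⊂ Δ(y′)»), (3.47) p. 398 («consequences of (3.42) and Lemma 2.1») with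
# [Balaban1984PropagatorsII] (2.49) p. 232, (2.51)–(2.52) p. 232, Lemma 2.1 (2.61) p. 234: **THE TWO-BACKGROUND LADDER READ BACK INTO THE NE9 CHAIN's CURRENCY** — the block majorant
# of `B9Thm34TowerVacuumLadder.exists_hasMajorant_GpOfUk_sub_flat` (`conj b (readA φ G′_k(U)) − conj b (readA φ G′_k(1)) ≺ B_J·α·e^{−δ_J d}`, constants before the lattice) becomes
# (i) the chain's `W`-valued BLOCK-SUP ROW `‖(G′_k(U)f)(x) − (G′_k(1)f)(x)‖_W ≤ K_J·α·e^{−δ_J d₁(y_x, v)}·sup‖f‖` for sources `f` carried by the `k`-block over `v`, and (ii) by the row sum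
# (2.61) of the one-scale geometry `towerGeom` the LATTICE-FREE SUP-NORM LIPSCHITZ LETTER `‖(G′_k(U)f)(x) − (G′_k(1)f)(x)‖_W ≤ K_J′·α·sup‖f‖` for EVERY source `f` — the shape the chain's
# `Support/NE9CurChartLipschitzAtFlat` consumes (there with a finite-lattice `K`), now with `K_J′` chosen before `n, η, m, U`

statement-level skeleton of published theorems with citation tags; proofs where landed; nothing here is a claim about the Yang–Mills mass gap

CITATION HEADER (lean-in-tree rule).  Audit cell `pub-balaban`, sub-cell `t4`, BINDER row NE9; NE9 crux-team LEAF PROVER 01 (`b2b-balaban-t4-ne9-formalise-leaf-01`,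
gen 99; bears_on: R4/N22).  Vocabulary BY NAME: pv08's `B6RandomWalk.HasMajorant` ∕ `Ineq261` ∕ `c1_nonneg` and `B6Ineq249Proof.supBound_of_hasMajorant` (the (2.49) summation step),
r06's `B9Eq352DivFormLetters.coordEquiv` ∕ `conj` ∕ `conj_apply` ∕ `conj_sub`, this lineage's `B9Eq342MajorantReadingSeam.blockRowW_of_hasMajorant_conj_readA` (the block-row read-back),
`B9Eq324PenaltyKernelForm.readA` ∕ `readA_apply` ∕ `readA_sub`, `B9Eq341TowerBlockGeometry.towerGeom` ∕ `h261_towerGeom`, `B9Eq357QprimeTowerKernelForm.blkK`,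
`B9Thm34TowerVacuumLadder.exists_hasMajorant_GpOfUk_sub_flat` (the ladder), the chain's `B9Eq324DeltaPrimeATower.GpOfUk`.  Sources read through those files' verbatim quotations:
[Balaban1985BackgroundPropagators] pp. 397–398, 400; [Balaban1984PropagatorsII] pp. 232, 234.  [folklore] finite-dimensional norm comparisons; COMPOSITION BY NAME; NOTHING of
print's proofs is reproduced beyond what the named files prove.

WHAT IS PROVED (sorry-free; proof lane — no `def`).
* §1 GENERIC: **`supRow_of_hasMajorant_conj`** — `conj b T ≺ K` with summable rows `Σ_{y′}K(y, y′) ≤ C` gives `‖(Tf)(x)‖ ≤ (Σ_i‖b_i‖)M₂C·sup‖f‖` for EVERY `f` ((2.49) + (2.51)).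
* §2 FIBRE: **`supRowW_of_supRowA`** — a sup row of `readA φ T` gives the `W`-valued sup row of `T` (constant `M_φ′M_φ·C`).
* §3 SEAM: **`supRowW_of_hasMajorant_conj_readA`** — `conj b (readA φ T) ≺ K`, `Σ_{y′}K(y, y′) ≤ C` ⟹ `‖(Tf)(x)‖_W ≤ M_φ′M_φ(Σ_i‖b_i‖)M₂C·sup‖f‖`.
* §4 AT THE LADDER: **`exists_blockRowW_GpOfUk_sub_flat`** — `∃ α_J, K_J ≥ 0, δ_J > 0` BEFORE the lattice: on print's class (as in the ladder file), for `f` vanishing off the `k`-block over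
  `v` with `‖f‖ ≤ F` there, `‖(G′_k(U)f)(x) − (G′_k(1)f)(x)‖_W ≤ K_J·α·e^{−δ_J·d₁(y_x, v)}·F`; **`exists_supRow_GpOfUk_sub_flat`** — `∃ α_J, K_J′ ≥ 0` BEFORE the lattice: on the same class,
  for EVERY `f` with `‖f(y)‖_W ≤ F`, `‖(G′_k(U)f)(x) − (G′_k(1)f)(x)‖_W ≤ K_J′·α·F` (`K_J′ = M_φ′M_φ(Σ‖b_i‖)M₂·B_J·c₁(d, δ_J, 1)` by (2.61) for `towerGeom`).
HONEST SCOPE.  Bookkeeping on top of the ladder file; constants crude (NOT print's); the Thm-3.1 inputs behind the ladder are the cell's MODEL rows («NE9 ⇐ the named binders»; O-NE9-1,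
#5 UNRULED); only `G′_k` (NOT `G_k`, `(Q′G′²Q′*)⁻¹`, `R_k`, nor the chain's `G̃_k`, `H̃_{1,k}`, `𝔊̃_k`); NE9 NOT PRINTED ∕ NOT PROVED; spine PROVED 0∕9; rung (B)+1 finite T⁴ — NOT
infinite volume, NOT mass gap, NOT BetaPertH, NOT Clay.  HONEST DEPENDENCY: continuum YM on T⁴ ⇐ BetaPertH ∧ nine spine estimates (0/9 proved); BetaPertH ⇐ (D1) ∧ (D4) ∧ CAP+tail;
G-an2-4 gates asym, D1 and NE2/3/4.  NEW file; nothing modified.  Net new unproved facts: 0.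
-/

noncomputable section

open scoped BigOperators InnerProductSpace

namespace Literature.MathematicalPhysics.QuantumFieldTheory.Balaban1983to89.B9Thm34TowerVacuumLadderRows

open B4Sect5Torus (TSite)
open B7Prop1Explicit (U1)
open B9SectCLatticeCarrier (Bond shift)
open B9Eq311L2Pairing (WL2)
open B11Eq103H1Complex (SiteL2K)
open B9Eq315QTower (towerP UlevOf)
open B9Eq324DeltaPrimeATower (laplacePrimeAk GpOfUk)
open B6RandomWalk (HasMajorant Ineq261 c1_nonneg)
open B6Ineq249Proof (supBound_of_hasMajorant)
open B9Thm34Ext (toB6)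
open B9Eq352DivFormLetters (coordEquiv coordEquiv_apply conj conj_apply conj_sub)
open B9Eq324PenaltyKernelForm (readA readA_apply readA_sub)
open B9Eq357QprimeTowerKernelForm (blkK)
open B9Eq341TowerBlockGeometry (towerGeom dist_towerGeom h261_towerGeom)
open B9Thm37GlueTorus (tdist1)
open B9Eq342MajorantReadingSeam (blockRowW_of_hasMajorant_conj_readA)
open B9Thm34TowerVacuumLadder (exists_hasMajorant_GpOfUk_sub_flat)

/-! ## §1 A block majorant with summable rows bounds the `E`-valued operator in sup norm -/

section Generic

variable {E : Type*} [NormedAddCommGroup E] [NormedSpace ℝ E] {ι : Type} [Fintype ι] (b : Module.Basis ι ℝ E) {S : Type}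
  {G : B6.Geometry} (blk : S → G.Site) {M₂ : ℝ} (hM₂ : 0 ≤ M₂) (hrepr : ∀ (v : E) (i : ι), |b.repr v i| ≤ M₂ * ‖v‖)
include hM₂ hrepr

/-- **MAJORANT WITH SUMMABLE ROWS ⇒ SUP ROW.**  If `conj b T ≺ K` over the block map `(x, i) ↦ blk x` and `Σ_{y′} K(y, y′) ≤ C` for every `y`, then for EVERY `f : S → E` with
`‖f(x)‖ ≤ B`: `‖(Tf)(x)‖ ≤ (Σ_i‖b_i‖)·M₂·C·B` (decompose the real coordinates of `f` over the blocks, (2.49), and read back through the basis, (2.51)).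
[cite: Balaban1984PropagatorsII, (2.49) p.232, (2.51)–(2.52) p.232; Balaban1985BackgroundPropagators, p.398 (remark before (3.47))] -/
theorem supRow_of_hasMajorant_conj (T : Module.End ℝ (S → E)) (K : G.Site → G.Site → ℝ)
    (hT : HasMajorant (g := G) (fun p : S × ι => blk p.1) (conj b T) K) {C : ℝ} (hrow : ∀ a, ∑ a', K a a' ≤ C)
    (f : S → E) (B : ℝ) (hB : 0 ≤ B) (hbd : ∀ x, ‖f x‖ ≤ B) (x : S) :
    ‖T f x‖ ≤ (∑ i, ‖b i‖) * M₂ * C * B := by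
  have hμ : ∀ p : S × ι, |coordEquiv b f p| ≤ M₂ * B := fun p => by
    rw [coordEquiv_apply]
    exact (hrepr _ _).trans (mul_le_mul_of_nonneg_left (hbd p.1) hM₂)
  have h1 : ∀ i, |b.repr (T f x) i| ≤ C * (M₂ * B) := fun i => by
    have h := supBound_of_hasMajorant (g := G) (fun p : S × ι => blk p.1) hT hrow (coordEquiv b f) (mul_nonneg hM₂ hB) hμ (x, i)
    rwa [conj_apply, LinearEquiv.symm_apply_apply] at h
  calc ‖T f x‖ = ‖∑ i, b.repr (T f x) i • b i‖ := by rw [Module.Basis.sum_repr]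
    _ ≤ ∑ i, ‖b.repr (T f x) i • b i‖ := norm_sum_le _ _
    _ ≤ ∑ i, ‖b i‖ * (C * (M₂ * B)) := Finset.sum_le_sum fun i _ => by
        rw [norm_smul, Real.norm_eq_abs, mul_comm]
        exact mul_le_mul_of_nonneg_left (h1 i) (norm_nonneg _)
    _ = (∑ i, ‖b i‖) * M₂ * C * B := by rw [← Finset.sum_mul]; ring

end Generic

/-! ## §2 The fibre reading of sup rows -/

section Fibre

variable {d : ℕ} {P : Fin d → ℕ} {𝔸 : Type*} [NormedRing 𝔸] [NormedAlgebra ℂ 𝔸] {W : Type*} [NormedAddCommGroup W] [InnerProductSpace ℂ W]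
  (φ : W ≃ₗ[ℂ] 𝔸) {c₀ : ℝ} {Mφ Mφ' : ℝ} (hMφ : 0 ≤ Mφ) (hMφ' : 0 ≤ Mφ') (hφ : ∀ w, ‖φ w‖ ≤ Mφ * ‖w‖) (hφ' : ∀ X, ‖φ.symm X‖ ≤ Mφ' * ‖X‖)
include hMφ hMφ' hφ hφ'

/-- **`𝔸`-SUP-ROW ⇒ `W`-SUP-ROW.**  A sup row of `readA φ T` with constant `C` (`‖(readA φ T g)(x)‖ ≤ C·B` whenever `‖g(y)‖ ≤ B`) gives the `W`-valued sup row of `T` with constant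
`M_φ′M_φ·C`. [cite: Balaban1985BackgroundPropagators, (3.11) p.392, p.398 (remark before (3.47))] -/
theorem supRowW_of_supRowA (T : SiteL2K ℂ d P c₀ W →ₗ[ℂ] SiteL2K ℂ d P c₀ W) {C : ℝ}
    (hT : ∀ (g : TSite d P → 𝔸) (B : ℝ), 0 ≤ B → (∀ x, ‖g x‖ ≤ B) → ∀ x, ‖readA φ T g x‖ ≤ C * B)
    (f : SiteL2K ℂ d P c₀ W) (F : ℝ) (hF : 0 ≤ F) (hbd : ∀ x, ‖WL2.equiv ℂ (fun _ : TSite d P => c₀) W f x‖ ≤ F) (x : TSite d P) :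
    ‖WL2.equiv ℂ (fun _ : TSite d P => c₀) W (T f) x‖ ≤ Mφ' * Mφ * C * F := by
  set g : TSite d P → 𝔸 := fun z => φ (WL2.equiv ℂ (fun _ : TSite d P => c₀) W f z) with hg
  have hgbd : ∀ z, ‖g z‖ ≤ Mφ * F := fun z => (hφ _).trans (mul_le_mul_of_nonneg_left (hbd z) hMφ)
  have h1 := hT g (Mφ * F) (mul_nonneg hMφ hF) hgbd x
  have hfg : ((WL2.equiv ℂ (fun _ : TSite d P => c₀) W).symm fun z => φ.symm (g z)) = f := by
    apply (WL2.equiv ℂ (fun _ : TSite d P => c₀) W).injective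
    funext z
    rw [Equiv.apply_symm_apply, hg, LinearEquiv.symm_apply_apply]
  have hread : readA φ T g x = φ (WL2.equiv ℂ (fun _ : TSite d P => c₀) W (T f) x) := by
    rw [readA_apply, hfg]
  calc ‖WL2.equiv ℂ (fun _ : TSite d P => c₀) W (T f) x‖ = ‖φ.symm (φ (WL2.equiv ℂ (fun _ : TSite d P => c₀) W (T f) x))‖ := by
        rw [LinearEquiv.symm_apply_apply]
    _ ≤ Mφ' * ‖φ (WL2.equiv ℂ (fun _ : TSite d P => c₀) W (T f) x)‖ := hφ' _
    _ = Mφ' * ‖readA φ T g x‖ := by rw [hread]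
    _ ≤ Mφ' * (C * (Mφ * F)) := mul_le_mul_of_nonneg_left h1 hMφ'
    _ = Mφ' * Mφ * C * F := by ring

end Fibre

/-! ## §3 The seam for sup rows -/

section Seam

variable {d : ℕ} {P : Fin d → ℕ} {𝔸 : Type*} [NormedRing 𝔸] [NormedAlgebra ℂ 𝔸] {W : Type*} [NormedAddCommGroup W] [InnerProductSpace ℂ W]
  (φ : W ≃ₗ[ℂ] 𝔸) {c₀ : ℝ} {Mφ Mφ' : ℝ} (hMφ : 0 ≤ Mφ) (hMφ' : 0 ≤ Mφ') (hφ : ∀ w, ‖φ w‖ ≤ Mφ * ‖w‖) (hφ' : ∀ X, ‖φ.symm X‖ ≤ Mφ' * ‖X‖)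
  {ι : Type} [Fintype ι] (b : Module.Basis ι ℝ 𝔸) {M₂ : ℝ} (hM₂ : 0 ≤ M₂) (hrepr : ∀ (v : 𝔸) (i : ι), |b.repr v i| ≤ M₂ * ‖v‖)
  {G : B6.Geometry} (bm : TSite d P → G.Site)
include hMφ hMφ' hφ hφ' hM₂ hrepr

/-- **MAJORANT WITH SUMMABLE ROWS ⇒ THE CHAIN's `W`-VALUED SUP ROW**: `conj b (readA φ T) ≺ K` with `Σ_{y′}K(y, y′) ≤ C` gives, for EVERY source `f` with `‖f(y)‖_W ≤ F`,
`‖(Tf)(x)‖_W ≤ M_φ′M_φ(Σ_i‖b_i‖)M₂·C·F`. [cite: Balaban1984PropagatorsII, (2.49) p.232, (2.51) p.232; Balaban1985BackgroundPropagators, p.398 (remark before (3.47))] -/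
theorem supRowW_of_hasMajorant_conj_readA (T : SiteL2K ℂ d P c₀ W →ₗ[ℂ] SiteL2K ℂ d P c₀ W) (K : G.Site → G.Site → ℝ)
    (hT : HasMajorant (g := G) (fun p : TSite d P × ι => bm p.1) (conj b (readA φ T)) K) {C : ℝ} (hrow : ∀ a, ∑ a', K a a' ≤ C)
    (f : SiteL2K ℂ d P c₀ W) (F : ℝ) (hF : 0 ≤ F) (hbd : ∀ x, ‖WL2.equiv ℂ (fun _ : TSite d P => c₀) W f x‖ ≤ F) (x : TSite d P) :
    ‖WL2.equiv ℂ (fun _ : TSite d P => c₀) W (T f) x‖ ≤ Mφ' * Mφ * ((∑ i, ‖b i‖) * M₂ * C) * F :=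
  supRowW_of_supRowA φ hMφ hMφ' hφ hφ' T (fun g B hB hg x => supRow_of_hasMajorant_conj b bm hM₂ hrepr (readA φ T) K hT hrow g B hB hg x) f F hF hbd x

end Seam

/-! ## §4 At the ladder: the rows of `G′_k(U) − G′_k(1)` in the chain's currency, constants before the lattice -/

section Main

variable {d : ℕ} (L : ℕ) [NeZero L] {𝔸 : Type*} [NormedRing 𝔸] [NormedAlgebra ℂ 𝔸] [CompleteSpace 𝔸] [NormOneClass 𝔸] [StarRing 𝔸] [FiniteDimensional ℂ 𝔸]
  {W : Type*} [NormedAddCommGroup W] [InnerProductSpace ℂ W] [FiniteDimensional ℂ W] (φ : W ≃ₗ[ℂ] 𝔸) {a' Mφ Mφ' : ℝ}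
  (hMφ : 0 ≤ Mφ) (hMφ' : 0 ≤ Mφ') (hφn : ∀ w, ‖φ w‖ ≤ Mφ * ‖w‖) (hφn' : ∀ X, ‖φ.symm X‖ ≤ Mφ' * ‖X‖) (ha' : 0 < a')
  {r : ℝ} (hr0 : 0 ≤ r) (hr1 : r < 1)
  (τ : 𝔸 →ₗ[ℂ] ℂ) (hτ₂ : ∀ X Y : 𝔸, τ (X * Y) = τ (Y * X)) (hφτ : ∀ X Y : 𝔸, ⟪φ.symm X, φ.symm Y⟫_ℂ = τ (star X * Y))
  {ι : Type} [Fintype ι] [DecidableEq ι] (b : Module.Basis ι ℝ 𝔸) {M₂ : ℝ} (hM₂ : 0 ≤ M₂) (hrepr : ∀ (v : 𝔸) (i : ι), |b.repr v i| ≤ M₂ * ‖v‖)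

include hMφ hMφ' hφn hφn' ha' hr0 hr1 hτ₂ hφτ hM₂ hrepr in
/-- **THE LADDER AS THE CHAIN's BLOCK-SUP ROW** — `∃ α_J > 0, K_J ≥ 0, δ_J > 0` BEFORE `n, η, m, U`: on print's small-field class of the ladder file, for every coarse site `v`, every source
`f` vanishing off the `k`-block over `v` with `‖f(y)‖_W ≤ F` there and every fine site `x`,
`‖(G′_k(U)f)(x) − (G′_k(1)f)(x)‖_W ≤ K_J·α·e^{−δ_J·d₁(y_x, v)}·F` (`d₁` the `ℓ¹` torus distance of `towerGeom`, `y_x = blkK x`).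
[cite: Balaban1985BackgroundPropagators, Thm 3.4 p.400, Thm 3.1 (3.42) p.397; Balaban1984PropagatorsII, (2.51) p.232] -/
theorem exists_blockRowW_GpOfUk_sub_flat (hd : 1 ≤ d) (hL3 : 3 ≤ L) :
    ∃ αJ KJ δJ : ℝ, 0 < αJ ∧ 0 ≤ KJ ∧ 0 < δJ ∧
      ∀ (n : ℕ) (η : ℝ), η * (L : ℝ) ^ (n + 1) = 1 →
      ∀ (c₀ c₁ : ℝ) [Fact (0 < c₀)] [Fact (0 < c₁)], c₀ * ((L : ℝ) ^ (n + 1)) ^ d = c₁ →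
      ∀ (m : Fin d → ℕ) [∀ i, NeZero (m i)] (U : Bond d (towerP L m (n + 1)) → 𝔸ˣ) (α : ℝ), 0 ≤ α → α ≤ αJ →
        (∀ bd, U bd ∈ U1 𝔸) → (∀ bd, ‖(U bd : 𝔸) - 1‖ ≤ α * η) →
        (∀ (x : TSite d (towerP L m (n + 1))) (μ ν : Fin d), ‖(U (shift ν x, μ) : 𝔸) - (U (x, μ) : 𝔸)‖ ≤ α * η ^ 2) →
      ∀ (εU : ℕ → ℝ), (∀ j, 0 ≤ εU j) → (∀ j, εU j ≤ 1) → (∀ j < n + 1, εU j ≤ α * r ^ j) →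
        (∀ (j : ℕ) (bd : Bond d (towerP L m (j + 1))), ‖(UlevOf L m (n + 1) U j bd : 𝔸) - 1‖ ≤ εU j) →
        (∀ (j : ℕ) (bd : Bond d (towerP L m (j + 1))), UlevOf L m (n + 1) U j bd ∈ U1 𝔸) →
      ∀ (hposU : ∀ x : SiteL2K ℂ d (towerP L m (n + 1)) c₀ W, x ≠ 0 → 0 < RCLike.re ⟪x, laplacePrimeAk L m n φ η U a' (c₁ := c₁) x⟫_ℂ)
        (hpos₁ : ∀ x : SiteL2K ℂ d (towerP L m (n + 1)) c₀ W, x ≠ 0 →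
          0 < RCLike.re ⟪x, laplacePrimeAk L m n φ η (fun _ : Bond d (towerP L m (n + 1)) => (1 : 𝔸ˣ)) a' (c₁ := c₁) x⟫_ℂ)
        (v : TSite d m) (f : SiteL2K ℂ d (towerP L m (n + 1)) c₀ W) (F : ℝ), 0 ≤ F →
        (∀ x, blkK L m n x ≠ v → WL2.equiv ℂ (fun _ : TSite d (towerP L m (n + 1)) => c₀) W f x = 0) →
        (∀ x, blkK L m n x = v → ‖WL2.equiv ℂ (fun _ : TSite d (towerP L m (n + 1)) => c₀) W f x‖ ≤ F) →
      ∀ x : TSite d (towerP L m (n + 1)),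
        ‖WL2.equiv ℂ (fun _ : TSite d (towerP L m (n + 1)) => c₀) W (GpOfUk L m n φ η U a' (c₁ := c₁) hposU f) x -
            WL2.equiv ℂ (fun _ : TSite d (towerP L m (n + 1)) => c₀) W
              (GpOfUk L m n φ η (fun _ : Bond d (towerP L m (n + 1)) => (1 : 𝔸ˣ)) a' (c₁ := c₁) hpos₁ f) x‖ ≤
          KJ * α * Real.exp (-(δJ * tdist1 m (blkK L m n x) v)) * F := by
  obtain ⟨αJ, BJ, δJ, hαJ, hBJ, hδJ, H⟩ :=
    exists_hasMajorant_GpOfUk_sub_flat L φ hMφ hMφ' hφn hφn' ha' hr0 hr1 τ hτ₂ hφτ b hM₂ hrepr hd hL3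
  have hSb : 0 ≤ ∑ i, ‖b i‖ := Finset.sum_nonneg fun i _ => norm_nonneg _
  refine ⟨αJ, Mφ' * Mφ * ((∑ i, ‖b i‖) * M₂ * BJ), δJ, hαJ, by positivity, hδJ, ?_⟩
  intro n η hη c₀ c₁ _ _ hc m _ U α hα0 hαJ' hU1 hUs hUw εU hε0 hε1 hεr hlev hlev1 hposU hpos₁ v f F hF hoff hbd x
  have hT := H n η hη c₀ c₁ hc m U α hα0 hαJ' hU1 hUs hUw εU hε0 hε1 hεr hlev hlev1 hposU hpos₁ 0 0 True
  rw [← conj_sub, ← readA_sub] at hT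
  have h := blockRowW_of_hasMajorant_conj_readA φ hMφ hMφ' hφn hφn' b hM₂ hrepr (G := toB6 (towerGeom L m n η 0) 0 True) (blkK L m n)
    _ _ hT v f F hF hoff hbd x
  rw [LinearMap.sub_apply, WL2.equiv_sub, Pi.sub_apply] at h
  refine h.trans (le_of_eq ?_)
  show Mφ' * Mφ * ((∑ i, ‖b i‖) * M₂ * (BJ * α * Real.exp (-(δJ * tdist1 m (blkK L m n x) v)))) * F = _
  ring

include hMφ hMφ' hφn hφn' ha' hr0 hr1 hτ₂ hφτ hM₂ hrepr in
/-- **THE LADDER AS A LATTICE-FREE SUP-NORM LIPSCHITZ LETTER** — `∃ α_J > 0, K_J′ ≥ 0` BEFORE `n, η, m, U`: on print's small-field class of the ladder file, for EVERY source `f` with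
`‖f(y)‖_W ≤ F` and every fine site `x`, `‖(G′_k(U)f)(x) − (G′_k(1)f)(x)‖_W ≤ K_J′·α·F` — the row sum (2.61) of `towerGeom` (`Σ_{v} e^{−δ_J d₁(y, v)} ≤ c₁(d, δ_J, 1)`, every period)
turns the block majorant into the `ℓ^∞ → ℓ^∞` bound, `K_J′ = M_φ′M_φ(Σ_i‖b_i‖)M₂·B_J·c₁(d, δ_J, 1)`.
[cite: Balaban1985BackgroundPropagators, Thm 3.4 p.400, p.398 (remark before (3.47)); Balaban1984PropagatorsII, (2.49) p.232, Lemma 2.1 (2.61) p.234] -/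
theorem exists_supRow_GpOfUk_sub_flat (hd : 1 ≤ d) (hL3 : 3 ≤ L) :
    ∃ αJ KJ : ℝ, 0 < αJ ∧ 0 ≤ KJ ∧
      ∀ (n : ℕ) (η : ℝ), η * (L : ℝ) ^ (n + 1) = 1 →
      ∀ (c₀ c₁ : ℝ) [Fact (0 < c₀)] [Fact (0 < c₁)], c₀ * ((L : ℝ) ^ (n + 1)) ^ d = c₁ →
      ∀ (m : Fin d → ℕ) [∀ i, NeZero (m i)] (U : Bond d (towerP L m (n + 1)) → 𝔸ˣ) (α : ℝ), 0 ≤ α → α ≤ αJ →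
        (∀ bd, U bd ∈ U1 𝔸) → (∀ bd, ‖(U bd : 𝔸) - 1‖ ≤ α * η) →
        (∀ (x : TSite d (towerP L m (n + 1))) (μ ν : Fin d), ‖(U (shift ν x, μ) : 𝔸) - (U (x, μ) : 𝔸)‖ ≤ α * η ^ 2) →
      ∀ (εU : ℕ → ℝ), (∀ j, 0 ≤ εU j) → (∀ j, εU j ≤ 1) → (∀ j < n + 1, εU j ≤ α * r ^ j) →
        (∀ (j : ℕ) (bd : Bond d (towerP L m (j + 1))), ‖(UlevOf L m (n + 1) U j bd : 𝔸) - 1‖ ≤ εU j) →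
        (∀ (j : ℕ) (bd : Bond d (towerP L m (j + 1))), UlevOf L m (n + 1) U j bd ∈ U1 𝔸) →
      ∀ (hposU : ∀ x : SiteL2K ℂ d (towerP L m (n + 1)) c₀ W, x ≠ 0 → 0 < RCLike.re ⟪x, laplacePrimeAk L m n φ η U a' (c₁ := c₁) x⟫_ℂ)
        (hpos₁ : ∀ x : SiteL2K ℂ d (towerP L m (n + 1)) c₀ W, x ≠ 0 →
          0 < RCLike.re ⟪x, laplacePrimeAk L m n φ η (fun _ : Bond d (towerP L m (n + 1)) => (1 : 𝔸ˣ)) a' (c₁ := c₁) x⟫_ℂ)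
        (f : SiteL2K ℂ d (towerP L m (n + 1)) c₀ W) (F : ℝ), 0 ≤ F →
        (∀ x, ‖WL2.equiv ℂ (fun _ : TSite d (towerP L m (n + 1)) => c₀) W f x‖ ≤ F) →
      ∀ x : TSite d (towerP L m (n + 1)),
        ‖WL2.equiv ℂ (fun _ : TSite d (towerP L m (n + 1)) => c₀) W (GpOfUk L m n φ η U a' (c₁ := c₁) hposU f) x -
            WL2.equiv ℂ (fun _ : TSite d (towerP L m (n + 1)) => c₀) W
              (GpOfUk L m n φ η (fun _ : Bond d (towerP L m (n + 1)) => (1 : 𝔸ˣ)) a' (c₁ := c₁) hpos₁ f) x‖ ≤ KJ * α * F := by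
  obtain ⟨αJ, BJ, δJ, hαJ, hBJ, hδJ, H⟩ :=
    exists_hasMajorant_GpOfUk_sub_flat L φ hMφ hMφ' hφn hφn' ha' hr0 hr1 τ hτ₂ hφτ b hM₂ hrepr hd hL3
  have hSb : 0 ≤ ∑ i, ‖b i‖ := Finset.sum_nonneg fun i _ => norm_nonneg _
  have hc1 : 0 ≤ B6.c1 d δJ 1 := c1_nonneg d δJ 1
  refine ⟨αJ, Mφ' * Mφ * ((∑ i, ‖b i‖) * M₂ * (BJ * B6.c1 d δJ 1)), hαJ, by positivity, ?_⟩
  intro n η hη c₀ c₁ _ _ hc m _ U α hα0 hαJ' hU1 hUs hUw εU hε0 hε1 hεr hlev hlev1 hposU hpos₁ f F hF hbd x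
  have hT := H n η hη c₀ c₁ hc m U α hα0 hαJ' hU1 hUs hUw εU hε0 hε1 hεr hlev hlev1 hposU hpos₁ 0 0 True
  rw [← conj_sub, ← readA_sub] at hT
  have h261 : Ineq261 d (toB6 (towerGeom L m n η 0) 0 True) δJ 1 := h261_towerGeom L m n η 0 0 True one_pos hδJ
  have hrow : ∀ a : (toB6 (towerGeom L m n η 0) 0 True).Site,
      ∑ a', BJ * α * Real.exp (-(δJ * (towerGeom L m n η 0).dist a a')) ≤ BJ * α * B6.c1 d δJ 1 := fun a => by
    rw [← Finset.mul_sum]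
    refine mul_le_mul_of_nonneg_left ?_ (mul_nonneg hBJ hα0)
    have h1 := h261 a
    rw [one_mul] at h1
    exact h1
  have h := supRowW_of_hasMajorant_conj_readA φ hMφ hMφ' hφn hφn' b hM₂ hrepr (G := toB6 (towerGeom L m n η 0) 0 True) (blkK L m n)
    _ _ hT hrow f F hF hbd x
  rw [LinearMap.sub_apply, WL2.equiv_sub, Pi.sub_apply] at h
  refine h.trans (le_of_eq ?_)
  ring

end Main

end Literature.MathematicalPhysics.QuantumFieldTheory.Balaban1983to89.B9Thm34TowerVacuumLadderRows

end
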